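import Mathlib
import Literature.MathematicalPhysics.QuantumFieldTheory.WilsonTorusTransferMatrix
import Literature.Analysis.OperatorTheory.CyclicChainCondExp
import Literature.MathematicalPhysics.QuantumFieldTheory.FreeTubeSliceAssembly
import HarnessLib

/-!
# The slice transfer kernel of the free tube: measurable, bounded, symmetric, of positive type

Companion of `WilsonTorusTransferMatrix.lean` (periodic torus) for the tube of `FreeTubeSliceAssembly.lean`.  For the
finite spatial slice `S` (spatial shifts `shS`, plaquette weights `insS ∈ {0, 1}`), the slice energy `Ssp`, the layer
energy `Stm` (variables with their defining equations) and the symmetrised slice kernel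
`K a b = e^{Ssp a/2} (∫ e^{Stm a e b} ∏_s de_s) e^{Ssp b/2}` (temporal links integrated against product Haar) we prove that
`K` is jointly measurable, bounded, non-negative, SYMMETRIC for unitary `ρ` (`E ↦ E⁻¹`, inversion invariance of Haar,
`Re tr ρ(g⁻¹) = Re tr ρ(g)`), and OF POSITIVE TYPE for `β ≥ 0` — Lüscher's theorem, transplanted from
`posType_wilsonSliceKernel`: fold the half-weights into the test function, double the temporal links `g = a b⁻¹`, gauge
away (`integral_integral_fibreAverage_nonneg`) and use the integral positive-definiteness of
`exp(β Σ (Re·Re + Im·Im))` of matrix entries (`Literature.Analysis.OperatorTheory.integral_mul_exp_sum_mul_mul_nonneg`);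
the free-face indicator `ins ∈ {0, 1}` only weights the features.

References: M. Lüscher, Commun. Math. Phys. 54 (1977) 283; K. Osterwalder, E. Seiler, Ann. Phys. 110 (1978) 440, §2.
-/

set_option autoImplicit false

noncomputable section

open scoped BigOperators
open MeasureTheory Filter Function
open Literature.MathematicalPhysics.QuantumFieldTheory Literature.Barriers.QuantumFields
  Literature.Analysis.OperatorTheory Literature.Analysis.OperatorTheory.CyclicChain

namespace Literature.MathematicalPhysics.QuantumFieldTheory.FreeTube

section Kernel

variable {G : Type*} [Group G] {S : Type*} [Fintype S] {n : ℕ} (ρ : G →* Matrix (Fin n) (Fin n) ℂ) (β : ℝ)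
  (shS : S → Fin 3 → S) (insS : S → Fin 4 → Fin 4 → ℝ) (hinsS : ∀ s μ κ, insS s μ κ = 0 ∨ insS s μ κ = 1)
  (Ssp : (S × Fin 3 → G) → ℝ)
  (hSsp : ∀ a, Ssp a = β * ∑ s : S, ∑ i : Fin 3, ∑ j : Fin 3, if i < j then insS s i.succ j.succ *
    (ρ (a (s, i) * a (shS s i, j) * (a (shS s j, i))⁻¹ * (a (s, j))⁻¹)).trace.re else 0)
  (Stm : (S × Fin 3 → G) → (S → G) → (S × Fin 3 → G) → ℝ)
  (hStm : ∀ a e b, Stm a e b = β * ∑ s : S, ∑ j : Fin 3, insS s 0 j.succ *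
    (ρ (e s * b (s, j) * (e (shS s j))⁻¹ * (a (s, j))⁻¹)).trace.re)

/-! #### Algebra of the layer energy -/

include hStm in
/-- **Swap symmetry of the layer energy**: exchanging the two slices and inverting the temporal links leaves `Stm`
invariant (unitary `ρ`; `trace_re_rep_plaquette_swap`). [folklore] -/
theorem stm_swap_inv (hρu : ∀ g, ρ g ∈ Matrix.unitaryGroup (Fin n) ℂ) (a b : S × Fin 3 → G) (e : S → G) :
    Stm b e⁻¹ a = Stm a e b := by
  rw [hStm, hStm]
  congr 1
  refine Finset.sum_congr rfl fun s _ => Finset.sum_congr rfl fun j _ => ?_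
  rw [Pi.inv_apply, Pi.inv_apply, trace_re_rep_plaquette_swap ρ hρu]

include hStm in
/-- **Gauge covariance of the layer energy**: `Stm(x^a, a b⁻¹, y^b) = Stm(x, 1, y)` for the slice gauge transformations
`x^a (s, i) = a s · x (s, i) · (a (s + î))⁻¹` (the temporal plaquettes become conjugates). [folklore] -/
theorem stm_gauge_div (a b : S → G) (x y : S × Fin 3 → G) :
    Stm (fun l => a l.1 * x l * (a (shS l.1 l.2))⁻¹) (a / b) (fun l => b l.1 * y l * (b (shS l.1 l.2))⁻¹) =
      Stm x 1 y := by
  rw [hStm, hStm]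
  congr 1
  refine Finset.sum_congr rfl fun s _ => Finset.sum_congr rfl fun j _ => ?_
  simp only [Pi.div_apply, Pi.one_apply, inv_one, one_mul, mul_one]
  have h : a s / b s * (b s * y (s, j) * (b (shS s j))⁻¹) * (a (shS s j) / b (shS s j))⁻¹ *
      (a s * x (s, j) * (a (shS s j))⁻¹)⁻¹ = (a s)⁻¹⁻¹ * (y (s, j) * (x (s, j))⁻¹) * (a s)⁻¹ := by
    simp only [div_eq_mul_inv]
    group
  rw [h, FiniteTemperature.trace_re_rep_conj]

include hinsS in
omit [Fintype S] in
/-- The plaquette weights are idempotent (`ins ∈ {0, 1}`). [folklore] -/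
theorem insS_mul_self (s : S) (μ κ : Fin 4) : insS s μ κ * insS s μ κ = insS s μ κ := by
  rcases hinsS s μ κ with h | h <;> simp [h]

include hinsS in
omit [Fintype S] in
/-- `|ins| ≤ 1`. [folklore] -/
theorem abs_insS_le_one (s : S) (μ κ : Fin 4) : |insS s μ κ| ≤ 1 := by
  rcases hinsS s μ κ with h | h <;> simp [h]

include hStm in
/-- **The un-averaged kernel in feature form**: `Stm(x, 1, y) = β Σ_{l,k,m} ins_l (Re ρ(x_l)_{km} Re ρ(y_l)_{km} +
Im ρ(x_l)_{km} Im ρ(y_l)_{km})` for unitary `ρ` (`ρ(g⁻¹) = ρ(g)ᴴ`). [folklore] -/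
theorem stm_one_eq_sum (hρu : ∀ g, ρ g ∈ Matrix.unitaryGroup (Fin n) ℂ) (x y : S × Fin 3 → G) :
    Stm x 1 y = β * ∑ t : (S × Fin 3) × Fin n × Fin n, insS t.1.1 0 t.1.2.succ *
      ((ρ (x t.1) t.2.1 t.2.2).re * (ρ (y t.1) t.2.1 t.2.2).re + (ρ (x t.1) t.2.1 t.2.2).im * (ρ (y t.1) t.2.1 t.2.2).im) := by
  rw [hStm]
  congr 1
  simp only [Pi.one_apply, inv_one, one_mul, mul_one, trace_re_rep_mul_inv_eq_sum ρ hρu, Finset.mul_sum,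
    Fintype.sum_prod_type]

/-! #### The kernel -/

variable [TopologicalSpace G] [IsTopologicalGroup G] [CompactSpace G] [MeasurableSpace G] [BorelSpace G]
  [SecondCountableTopology G]
  (K : (S × Fin 3 → G) → (S × Fin 3 → G) → ℝ)
  (hK : ∀ a b, K a b = Real.exp (Ssp a / 2) *
    (∫ e, Real.exp (Stm a e b) ∂(Measure.pi fun _ : S => haarProbability G)) * Real.exp (Ssp b / 2))

include hSsp in
omit [CompactSpace G] in
/-- The slice energy is measurable. [folklore] -/
theorem measurable_Ssp (hρ : Continuous ρ) : Measurable Ssp :=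
  (continuous_Ssp ρ β shS insS Ssp hSsp hρ).measurable

include hStm in
omit [CompactSpace G] in
/-- The layer energy is jointly measurable. [folklore] -/
theorem measurable_Stm (hρ : Continuous ρ) :
    Measurable fun z : (S × Fin 3 → G) × (S → G) × (S × Fin 3 → G) => Stm z.1 z.2.1 z.2.2 :=
  (continuous_Stm ρ β shS insS Stm hStm hρ).measurable

include hSsp hStm hK in
/-- **The slice kernel is jointly measurable.** [folklore] -/
theorem measurable_uncurry_K (hρ : Continuous ρ) : Measurable (uncurry K) := by
  have h : uncurry K = fun ab : (S × Fin 3 → G) × (S × Fin 3 → G) => Real.exp (Ssp ab.1 / 2) *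
      (∫ e, Real.exp (Stm ab.1 e ab.2) ∂(Measure.pi fun _ : S => haarProbability G)) * Real.exp (Ssp ab.2 / 2) :=
    funext fun ab => hK ab.1 ab.2
  rw [h]
  have hS := measurable_Ssp ρ β shS insS Ssp hSsp hρ
  exact (((hS.comp measurable_fst).div_const 2).exp.mul
    (measurable_integral_exp_layer (Measure.pi fun _ : S => haarProbability G) Stm
      (measurable_Stm ρ β shS insS Stm hStm hρ))).mul ((hS.comp measurable_snd).div_const 2).exp

include hK in
omit [SecondCountableTopology G] in
/-- **The slice kernel is non-negative.** [folklore] -/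
theorem K_nonneg (a b : S × Fin 3 → G) : 0 ≤ K a b := by
  rw [hK]
  exact mul_nonneg (mul_nonneg (Real.exp_pos _).le (integral_nonneg fun _ => (Real.exp_pos _).le)) (Real.exp_pos _).le

include hSsp hStm hK in
omit [SecondCountableTopology G] in
/-- **The slice kernel is bounded.** [folklore] -/
theorem exists_K_le (hρ : Continuous ρ) : ∃ B : ℝ, ∀ a b, K a b ≤ B := by
  obtain ⟨B₁, hB₁⟩ := exists_abs_Ssp_le ρ β shS insS Ssp hSsp hρ
  obtain ⟨B₂, hB₂⟩ := exists_abs_Stm_le ρ β shS insS Stm hStm hρ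
  refine ⟨Real.exp (B₁ / 2) * Real.exp B₂ * Real.exp (B₁ / 2), fun a b => ?_⟩
  rw [hK]
  have h1 : ∀ c, Real.exp (Ssp c / 2) ≤ Real.exp (B₁ / 2) := fun c =>
    Real.exp_le_exp.2 (by linarith [(abs_le.1 (hB₁ c)).2])
  have h2 : ∫ e, Real.exp (Stm a e b) ∂(Measure.pi fun _ : S => haarProbability G) ≤ Real.exp B₂ := by
    have h := norm_integral_le_of_norm_le_const (μ := Measure.pi fun _ : S => haarProbability G)
      (f := fun e => Real.exp (Stm a e b)) (C := Real.exp B₂) (Eventually.of_forall fun e => by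
        rw [Real.norm_eq_abs, Real.abs_exp]; exact Real.exp_le_exp.2 (abs_le.1 (hB₂ a e b)).2)
    rw [probReal_univ, mul_one, Real.norm_eq_abs] at h
    exact (le_abs_self _).trans h
  exact mul_le_mul (mul_le_mul (h1 a) h2 (integral_nonneg fun _ => (Real.exp_pos _).le) (Real.exp_pos _).le)
    (h1 b) (Real.exp_pos _).le (mul_nonneg (Real.exp_pos _).le (Real.exp_pos _).le)

include hStm hK in
omit [SecondCountableTopology G] in
/-- **The slice kernel is symmetric** for unitary `ρ` (`E ↦ E⁻¹` in the layer integral, inversion invariance of the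
product Haar probability measure, `stm_swap_inv`): self-adjointness of the transfer matrix.
[cite: OsterwalderSeiler1978, §2] -/
theorem K_symm (hρu : ∀ g, ρ g ∈ Matrix.unitaryGroup (Fin n) ℂ) (a b : S × Fin 3 → G) : K a b = K b a := by
  have hM : ∫ e, Real.exp (Stm a e b) ∂(Measure.pi fun _ : S => haarProbability G) =
      ∫ e, Real.exp (Stm b e a) ∂(Measure.pi fun _ : S => haarProbability G) := by
    rw [← integral_inv_eq_self (fun e : S → G => Real.exp (Stm b e a)) (Measure.pi fun _ : S => haarProbability G)]
    refine integral_congr_ae (Eventually.of_forall fun e => ?_)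
    dsimp only
    rw [stm_swap_inv ρ β shS insS Stm hStm hρu]
  rw [hK, hK, hM]
  ring

include hStm hinsS in
/-- **Integral positive-definiteness of the un-averaged kernel** `exp(Stm(x, 1, y) − B)`, `β ≥ 0`, against bounded
measurable functions of the slice: `integral_mul_exp_sum_mul_mul_nonneg` with the real feature map
`√ins · (Re, Im)` of the matrix entries of all `ρ(x_l)` (here `ins ∈ {0,1}` is idempotent). [cite: Luscher1977] -/
theorem posType_exp_stm_one (hρ : Continuous ρ) (hρu : ∀ g, ρ g ∈ Matrix.unitaryGroup (Fin n) ℂ) (hβ : 0 ≤ β)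
    (B : ℝ) (φ : (S × Fin 3 → G) → ℝ) (hφ : Measurable φ) (hφ1 : ∀ x, |φ x| ≤ 1) :
    0 ≤ ∫ z, φ z.1 * Real.exp (Stm z.1 1 z.2 - B) * φ z.2
      ∂((Measure.pi fun _ : S × Fin 3 => haarProbability G).prod
        (Measure.pi fun _ : S × Fin 3 => haarProbability G)) := by
  obtain ⟨p, ⟨e⟩⟩ := Finite.exists_equiv_fin
    (((S × Fin 3) × Fin n × Fin n) ⊕ ((S × Fin 3) × Fin n × Fin n))
  obtain ⟨w, hw⟩ : ∃ w : ((S × Fin 3) × Fin n × Fin n) ⊕ ((S × Fin 3) × Fin n × Fin n) →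
      (S × Fin 3 → G) → ℝ, w = Sum.elim (fun t x => insS t.1.1 0 t.1.2.succ * (ρ (x t.1) t.2.1 t.2.2).re)
        (fun t x => insS t.1.1 0 t.1.2.succ * (ρ (x t.1) t.2.1 t.2.2).im) := ⟨_, rfl⟩
  have hwm : ∀ j, Measurable (w j) := by
    rw [hw]; rintro (t | t)
    · exact (continuous_const.mul (Complex.continuous_re.comp
        ((hρ.comp (continuous_apply t.1)).matrix_elem t.2.1 t.2.2))).measurable
    · exact (continuous_const.mul (Complex.continuous_im.comp
        ((hρ.comp (continuous_apply t.1)).matrix_elem t.2.1 t.2.2))).measurable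
  have hw1 : ∀ j x, |w j x| ≤ 1 := by
    rw [hw]; rintro (t | t) x
    · rw [Sum.elim_inl, abs_mul]
      exact mul_le_one₀ (abs_insS_le_one insS hinsS _ _ _) (abs_nonneg _)
        ((Complex.abs_re_le_norm _).trans (entry_norm_bound_of_unitary (hρu _) _ _))
    · rw [Sum.elim_inr, abs_mul]
      exact mul_le_one₀ (abs_insS_le_one insS hinsS _ _ _) (abs_nonneg _)
        ((Complex.abs_im_le_norm _).trans (entry_norm_bound_of_unitary (hρu _) _ _))
  have hS : ∀ x y : S × Fin 3 → G, Stm x 1 y - B = -B + β * ∑ j, w (e.symm j) x * w (e.symm j) y := by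
    intro x y
    rw [Equiv.sum_comp e.symm (fun j => w j x * w j y), Fintype.sum_sum_type,
      stm_one_eq_sum ρ β shS insS Stm hStm hρu x y, ← Finset.sum_add_distrib]
    simp only [hw, Sum.elim_inl, Sum.elim_inr]
    have hi : ∀ t : (S × Fin 3) × Fin n × Fin n, insS t.1.1 0 t.1.2.succ *
        ((ρ (x t.1) t.2.1 t.2.2).re * (ρ (y t.1) t.2.1 t.2.2).re + (ρ (x t.1) t.2.1 t.2.2).im * (ρ (y t.1) t.2.1 t.2.2).im) =
        insS t.1.1 0 t.1.2.succ * (ρ (x t.1) t.2.1 t.2.2).re * (insS t.1.1 0 t.1.2.succ * (ρ (y t.1) t.2.1 t.2.2).re) +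
          insS t.1.1 0 t.1.2.succ * (ρ (x t.1) t.2.1 t.2.2).im * (insS t.1.1 0 t.1.2.succ * (ρ (y t.1) t.2.1 t.2.2).im) := by
      intro t
      have h2 := insS_mul_self insS hinsS t.1.1 0 t.1.2.succ
      linear_combination (-((ρ (x t.1) t.2.1 t.2.2).re * (ρ (y t.1) t.2.1 t.2.2).re) -
        (ρ (x t.1) t.2.1 t.2.2).im * (ρ (y t.1) t.2.1 t.2.2).im) * h2
    simp_rw [hi]
    ring
  have hexp : ∀ z : (S × Fin 3 → G) × (S × Fin 3 → G), φ z.1 * Real.exp (Stm z.1 1 z.2 - B) * φ z.2 =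
      Real.exp (-B) * (φ z.1 * Real.exp (β * ∑ j, w (e.symm j) z.1 * w (e.symm j) z.2) * φ z.2) := fun z => by
    rw [hS, Real.exp_add]; ring
  simp_rw [hexp]
  rw [integral_const_mul]
  exact mul_nonneg (Real.exp_pos _).le
    (integral_mul_exp_sum_mul_mul_nonneg _ (fun x j => w (e.symm j) x) (fun j => hwm _) 1
      (fun x j => hw1 _ _) β hβ φ hφ 1 hφ1)

include hSsp hStm hinsS hK in
/-- **Lüscher's theorem for the free tube: the slice kernel is of positive type** against bounded measurable functions,
`β ≥ 0`: `∫∫ f(x) K(x, y) f(y) dμ dμ ≥ 0` — the half-weights `e^{Ssp/2}` folded into `f`,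
`integral_integral_fibreAverage_nonneg` with the slice gauge transformations as fibre action, `(a, b) ↦ a / b` as
doubling map and `exp(Stm(·, 1, ·) − B)` as un-averaged kernel (`posType_exp_stm_one`).  This is the positivity `𝕋 ≥ 0`
of the transfer matrix of the free tube. [cite: Luscher1977] [cite: OsterwalderSeiler1978, §2] -/
theorem posType_K (hρ : Continuous ρ) (hρu : ∀ g, ρ g ∈ Matrix.unitaryGroup (Fin n) ℂ) (hβ : 0 ≤ β)
    (f : (S × Fin 3 → G) → ℝ) (hf : Measurable f) (hf1 : ∀ x, |f x| ≤ 1) :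
    0 ≤ ∫ x, ∫ y, f x * K x y * f y ∂(Measure.pi fun _ : S × Fin 3 => haarProbability G)
      ∂(Measure.pi fun _ : S × Fin 3 => haarProbability G) := by
  obtain ⟨B₁, hB₁⟩ := exists_abs_Ssp_le ρ β shS insS Ssp hSsp hρ
  obtain ⟨B₂, hB₂⟩ := exists_abs_Stm_le ρ β shS insS Stm hStm hρ
  set μX : Measure (S × Fin 3 → G) := Measure.pi fun _ : S × Fin 3 => haarProbability G with hμX
  set μY : Measure (S → G) := Measure.pi fun _ : S => haarProbability G with hμY
  have hSm := measurable_Ssp ρ β shS insS Ssp hSsp hρ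
  have hStmc := continuous_Stm ρ β shS insS Stm hStm hρ
  -- the test function with the half-weights folded in
  have hF : Measurable fun x : S × Fin 3 → G => f x * Real.exp (Ssp x / 2 - B₁ / 2) :=
    hf.mul ((hSm.div_const 2).sub_const _).exp
  have hF1 : ∀ x : S × Fin 3 → G, |f x * Real.exp (Ssp x / 2 - B₁ / 2)| ≤ 1 := fun x => by
    rw [abs_mul, Real.abs_exp]
    refine mul_le_one₀ (hf1 x) (Real.exp_pos _).le (Real.exp_le_one_iff.2 ?_)
    linarith [(abs_le.1 (hB₁ x)).2]
  -- the un-averaged kernel, normalised to be `≤ 1`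
  have hk : Measurable fun q : (S × Fin 3 → G) × (S → G) × (S × Fin 3 → G) => Real.exp (Stm q.1 q.2.1 q.2.2 - B₂) :=
    (hStmc.measurable.sub_const _).exp
  have hk1 : ∀ (x : S × Fin 3 → G) (g : S → G) (y : S × Fin 3 → G), |Real.exp (Stm x g y - B₂)| ≤ 1 := fun x g y => by
    rw [Real.abs_exp, Real.exp_le_one_iff]
    linarith [(abs_le.1 (hB₂ x g y)).2]
  have hk₀c : Continuous fun z : (S × Fin 3 → G) × (S × Fin 3 → G) => Stm z.1 1 z.2 :=
    hStmc.comp (continuous_fst.prodMk (continuous_const.prodMk continuous_snd))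
  have hk₀ : Measurable fun z : (S × Fin 3 → G) × (S × Fin 3 → G) => Real.exp (Stm z.1 1 z.2 - B₂) :=
    (hk₀c.measurable.sub_const _).exp
  -- the fibre action: slice gauge transformations, and the doubling map
  have hTm : Measurable fun q : (S → G) × (S × Fin 3 → G) =>
      (fun l : S × Fin 3 => q.1 l.1 * q.2 l * (q.1 (shS l.1 l.2))⁻¹) := by
    refine (continuous_pi fun l => ?_).measurable
    exact (((continuous_apply l.1).comp continuous_fst).mul ((continuous_apply l).comp continuous_snd)).mul
      ((continuous_apply (shS l.1 l.2)).comp continuous_fst).inv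
  have hT : ∀ a : S → G, MeasurePreserving (fun (x : S × Fin 3 → G) (l : S × Fin 3) => a l.1 * x l * (a (shS l.1 l.2))⁻¹)
      μX μX := fun a =>
    measurePreserving_pi (f := fun (l : S × Fin 3) (g : G) => a l.1 * g * (a (shS l.1 l.2))⁻¹)
      (fun _ : S × Fin 3 => haarProbability G) (fun _ : S × Fin 3 => haarProbability G)
      fun l => WilsonGauge.measurePreserving_mul_mul (a l.1) (a (shS l.1 l.2))⁻¹
  have hD : MeasurePreserving (fun p : (S → G) × (S → G) => p.1 / p.2) (μY.prod μY) μY :=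
    (measurePreserving_fst (μ := μY) (ν := μY)).comp (measurePreserving_div_prod μY μY)
  have hkT : ∀ (p : (S → G) × (S → G)) (z : (S × Fin 3 → G) × (S × Fin 3 → G)),
      Real.exp (Stm (fun l : S × Fin 3 => p.1 l.1 * z.1 l * (p.1 (shS l.1 l.2))⁻¹) (p.1 / p.2)
        (fun l : S × Fin 3 => p.2 l.1 * z.2 l * (p.2 (shS l.1 l.2))⁻¹) - B₂) = Real.exp (Stm z.1 1 z.2 - B₂) :=
    fun p z => by rw [stm_gauge_div ρ β shS insS Stm hStm]
  -- fold the constants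
  have heq : ∀ x y : S × Fin 3 → G, f x * K x y * f y = Real.exp (B₁ / 2 + B₂ + B₁ / 2) *
      ((f x * Real.exp (Ssp x / 2 - B₁ / 2)) * (∫ g, Real.exp (Stm x g y - B₂) ∂μY) *
        (f y * Real.exp (Ssp y / 2 - B₁ / 2))) := fun x y => by
    simp_rw [Real.exp_sub, integral_div, hK, Real.exp_add]
    field_simp
  simp_rw [heq, integral_const_mul]
  refine mul_nonneg (Real.exp_pos _).le ?_
  exact integral_integral_fibreAverage_nonneg μX μY
    (fun (a : S → G) (x : S × Fin 3 → G) (l : S × Fin 3) => a l.1 * x l * (a (shS l.1 l.2))⁻¹) hTm hT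
    (fun p => p.1 / p.2) hD (fun x => f x * Real.exp (Ssp x / 2 - B₁ / 2)) hF hF1
    (fun x g y => Real.exp (Stm x g y - B₂)) hk hk1 (fun z => Real.exp (Stm z.1 1 z.2 - B₂)) hk₀ (fun z => hk1 _ _ _)
    hkT (posType_exp_stm_one ρ β shS insS hinsS Stm hStm hρ hρu hβ B₂)

end Kernel

end Literature.MathematicalPhysics.QuantumFieldTheory.FreeTube

end
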